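import Literature.NumberTheory.Sieve.BombieriFriedlanderIwaniecDispersionS2
import Literature.NumberTheory.Sieve.BombieriFriedlanderIwaniecTheorem5Reciprocity
import HarnessLib

/-!
# Bombieri–Friedlander–Iwaniec 1986, §6 for Theorem 1: `𝒮₁(coprime pairs) = f̂(0) 𝒳 + ℛ₁ + …`

Topic `Literature/NumberTheory/Sieve`.  Fourth file of the formalisation of the provable part of the
proof of Theorem 1 of E. Bombieri, J. B. Friedlander, H. Iwaniec, *Primes in arithmetic
progressions to large moduli*, Acta Math. 156 (1986), 203–251, after `…DispersionSmoothing` (§3),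
`…DispersionS3` (§4) and `…DispersionS2` (§5).  This is §6 (pp. 219–221), "A truncation of `𝒮₁`",
for BFI's weight `f = BFI.bump M Y`: the solution class of the simultaneous congruences (6.1),
Poisson summation (Lemma 2) modulo `L = q₀q₁q₂r` (in the notation `qᵢ = q₀qᵢ'`, i.e.
`L = [q₁,q₂] r`), the phase identity (6.10), and the decomposition (6.11)
`𝒮₁ = f̂(0) 𝒳 + ℛ₁ + O(…)` with `𝒳` (6.13) and `ℛ₁` (6.14).  Everything here is PROVED; no named
facts are introduced.

## What is and is not truncated here

BFI first discard the terms with `q₀ = (q₁,q₂) > Q₀ = ℒ^{A+B}` and with `(n₁,n₂) = n₀ > N₀`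
((6.3)–(6.7), using Lemma 3), and then impose (A₄) (so that `n₀ ≤ N₀` means `n₀ = 1`).  This file
splits `𝒮₁` accordingly into the MAIN RANGE `BFI.Main`: `(n₁, n₂) = 1` and `q₀ ≤ Q₀` (a free real
threshold `Q₀`), giving `BFI.dS1c`, and the rest `BFI.dS1n` (to be bounded by Lemma 3 as in
(6.3)–(6.4), elsewhere), and analyses `BFI.dS1c` exactly.  The squarefree condition `μ²(n₁n₂)` of
(6.8) is not used for Theorem 1 and is not imposed.

## Contents

* `BFI.Conds` (the condition of `A₁`: (6.1) with the coprimality of `𝒢`), `BFI.lmod = [q₁,q₂]r`,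
  `BFI.gmod = q₀r`, `BFI.conds_consequences`, **`BFI.conds_iff_modEq`** (the solutions of (6.1)
  form one class modulo `L`), **`BFI.exists_conds`** (solvability under `n₁ ≡ n₂ (q₀r)`, Chinese
  remainder theorem), `BFI.Solvable`, `BFI.solvable_iff`, `BFI.solClass` (`μ mod L`),
  `BFI.mA1_bump_eq` (`A₁ = [solvable] · A(L, μ)`, `A = BFI.classSum`).
* `BFI.tInt = (n₁−n₂)/(q₀r)`, `BFI.uNat = (n₂q₁')⁻¹ mod n₁q₂'`, `BFI.bfiPhase`,
  `BFI.gcd_div_facts`, **`BFI.phase_dvd`** — (6.10) as the divisibility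
  `L n₁ ∣ μ n₁ − a t u q₀q₁'r − a` for `(n₁,n₂) = 1` (an exact integer identity plus
  `(n₁q₂', n₂q₁') = 1`), **`BFI.norm_twCoef_sub_phase_le`**
  (`‖e(μh/L)Φ_L(h) − e(bfiPhase h)Φ_L(h)‖ ≤ 2π|h||a|(M+2Y)/(Ln₁)`, the `O(|ah|/(q₀q₁q₂rn₁))` of
  (6.10) in the tree's Fourier conventions `e(+μh/L)`, `Φ_L(h) = 𝓕f(h/L) = BFI.fcoef`).
* `BFI.Main`, `BFI.dS1c`, `BFI.dS1n`, `BFI.dS1_eq_dS1c_add_dS1n`; `BFI.calX` (**`𝒳`**, (6.13)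
  without `μ²`), `BFI.oscR`, `BFI.calR1` (**`ℛ₁`**, (6.14) likewise), `BFI.errS1`,
  `BFI.norm_oscSum_sub_oscR_le`, `BFI.norm_dS1c_term_sub_le`, and
  **`BFI.norm_dS1c_sub_calX_sub_calR1_le`**: for `0 < Y ≤ M`, `N, Q, R ≥ 0`, `H ≥ 0`, `j ≥ 2`,
  `‖𝒮₁ᶜ − α̂₀ 𝒳 − ℛ₁‖ ≤ ∑_{main, solvable} |γγββ| (L⁻¹ tailBound(Y,j,L,H) + L⁻¹ 2(M+2Y) 2π|a|H²/(Ln₁))`.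

## Faithfulness

`𝒳` and `ℛ₁` are BFI's (6.13), (6.14) summed over `(r, q₁, q₂, n₁, n₂)` in the original variables
(`q₀ = (q₁,q₂)`, `L = [q₁,q₂]r`), restricted to the main range and to solvable (6.1), i.e. to
`(q₁q₂r,a) = 1`, `(nᵢ,qᵢr) = 1`, `n₁ ≡ n₂ (q₀r)` (`BFI.solvable_iff`); the frequencies run over
`1 ≤ |h| ≤ H` with a free `H` (BFI: `H = x^ε M⁻¹ Q² R`, (6.9)); the sign convention of the phase is
Mathlib's (`h ↦ −h` relative to the print, immaterial for §8).  The errors are kept explicit; their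
admissibility ((6.11)–(6.12)) is part of the assembly of Theorem 1.

## References

* E. Bombieri, J. B. Friedlander, H. Iwaniec, Acta Math. 156 (1986), 203–251, §6 pp. 219–221,
  (6.1)–(6.14); §8 p. 226. [BombieriFriedlanderIwaniecActa1986]
-/

noncomputable section

open Finset Real
open scoped ArithmeticFunction.sigma FourierTransform

namespace Literature.NumberTheory.Sieve

namespace BFI

open scoped FourierTransform

/-! ### The summation condition of `A₁` and its solution class -/

/-- The condition of the `m`-sum `A₁` of `𝒮₁` at `(r, q₁, q₂, n₁, n₂, m)`:
`(q₁q₂r, am) = 1`, `mn₁ ≡ a (q₁r)`, `mn₂ ≡ a (q₂r)` (BFI (6.1)).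
[cite: BombieriFriedlanderIwaniecActa1986, §6 (6.1) p. 219] -/
abbrev Conds (a : ℤ) (r q₁ q₂ n₁ n₂ m : ℕ) : Prop :=
  Cop a r q₁ q₂ m ∧ ((m * n₁ : ℕ) : ZMod (q₁ * r)) = (a : ZMod (q₁ * r)) ∧
    ((m * n₂ : ℕ) : ZMod (q₂ * r)) = (a : ZMod (q₂ * r))

/-- `A₁` as a sum over the `m ∈ S` satisfying `Conds`. [folklore] -/
theorem mA1_eq_sum_filter (a : ℤ) (S : Finset ℕ) (w : ℕ → ℝ) (r q₁ q₂ n₁ n₂ : ℕ) :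
    mA1 a S w r q₁ q₂ n₁ n₂ = ∑ m ∈ S.filter (fun m => Conds a r q₁ q₂ n₁ n₂ m), w m := by
  unfold mA1
  rw [Finset.sum_filter]

/-- The modulus `L = [q₁r, q₂r] = [q₁, q₂] r = q₀ q₁' q₂' r` of the solution class of (6.1).
[cite: BombieriFriedlanderIwaniecActa1986, §6 p. 219] -/
def lmod (r q₁ q₂ : ℕ) : ℕ := Nat.lcm q₁ q₂ * r

/-- The modulus `q₀ r = (q₁r, q₂r)` of the compatibility condition `n₁ ≡ n₂ (q₀ r)`.
[cite: BombieriFriedlanderIwaniecActa1986, §6 p. 219] -/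
def gmod (r q₁ q₂ : ℕ) : ℕ := Nat.gcd q₁ q₂ * r

/-- `[q₁r, q₂r] = [q₁,q₂] r`. [folklore] -/
theorem lcm_mul_eq_lmod (r q₁ q₂ : ℕ) : Nat.lcm (q₁ * r) (q₂ * r) = lmod r q₁ q₂ :=
  Nat.lcm_mul_right q₁ r q₂

/-- `(q₁r, q₂r) = (q₁,q₂) r`. [folklore] -/
theorem gcd_mul_eq_gmod (r q₁ q₂ : ℕ) : Nat.gcd (q₁ * r) (q₂ * r) = gmod r q₁ q₂ :=
  Nat.gcd_mul_right q₁ r q₂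

/-- `q₁ r ∣ L`. [folklore] -/
theorem dvd_lmod_left (r q₁ q₂ : ℕ) : q₁ * r ∣ lmod r q₁ q₂ := by
  rw [← lcm_mul_eq_lmod]; exact Nat.dvd_lcm_left _ _

/-- `q₂ r ∣ L`. [folklore] -/
theorem dvd_lmod_right (r q₁ q₂ : ℕ) : q₂ * r ∣ lmod r q₁ q₂ := by
  rw [← lcm_mul_eq_lmod]; exact Nat.dvd_lcm_right _ _

/-- `q₀ r ∣ q₁ r`. [folklore] -/
theorem gmod_dvd_left (r q₁ q₂ : ℕ) : gmod r q₁ q₂ ∣ q₁ * r := by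
  rw [← gcd_mul_eq_gmod]; exact Nat.gcd_dvd_left _ _

/-- `q₀ r ∣ q₂ r`. [folklore] -/
theorem gmod_dvd_right (r q₁ q₂ : ℕ) : gmod r q₁ q₂ ∣ q₂ * r := by
  rw [← gcd_mul_eq_gmod]; exact Nat.gcd_dvd_right _ _

/-- `L > 0` for `r, q₁, q₂ > 0`. [folklore] -/
theorem lmod_pos {r q₁ q₂ : ℕ} (hr : 0 < r) (hq₁ : 0 < q₁) (hq₂ : 0 < q₂) : 0 < lmod r q₁ q₂ :=
  Nat.mul_pos (Nat.lcm_pos hq₁ hq₂) hr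

/-- `q₀ r > 0` for `r, q₁ > 0`. [folklore] -/
theorem gmod_pos {r q₁ q₂ : ℕ} (hr : 0 < r) (hq₁ : 0 < q₁) : 0 < gmod r q₁ q₂ :=
  Nat.mul_pos (Nat.gcd_pos_of_pos_left _ hq₁) hr

/-- `lmod · gmod = q₁ q₂ r · r`, i.e. `[q₁,q₂](q₁,q₂) = q₁q₂`. [folklore] -/
theorem lmod_mul_gcd (r q₁ q₂ : ℕ) : lmod r q₁ q₂ * Nat.gcd q₁ q₂ = q₁ * q₂ * r := by
  unfold lmod
  have h := Nat.gcd_mul_lcm q₁ q₂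
  calc Nat.lcm q₁ q₂ * r * Nat.gcd q₁ q₂ = (Nat.gcd q₁ q₂ * Nat.lcm q₁ q₂) * r := by ring
    _ = q₁ * q₂ * r := by rw [h]

/-- What `Conds` forces: `(q₁q₂r, a) = 1`, `(nᵢ, qᵢr) = 1`, `(m, q₁q₂r) = 1`, `n₁ ≡ n₂ (q₀ r)`.
[cite: BombieriFriedlanderIwaniecActa1986, §6 p. 219] -/
theorem conds_consequences {a : ℤ} {r q₁ q₂ n₁ n₂ m : ℕ} (h : Conds a r q₁ q₂ n₁ n₂ m) :
    IsCoprime ((q₁ * q₂ * r : ℕ) : ℤ) a ∧ n₁.Coprime (q₁ * r) ∧ n₂.Coprime (q₂ * r) ∧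
      m.Coprime (q₁ * q₂ * r) ∧ (n₁ : ZMod (gmod r q₁ q₂)) = (n₂ : ZMod (gmod r q₁ q₂)) := by
  obtain ⟨hc, h1, h2⟩ := h
  have hk := (cop_iff a r q₁ q₂ m).1 hc
  have hd₁ : IsCoprime ((q₁ * r : ℕ) : ℤ) a := isCoprime_mul_of_cop hc
  have hd₂ : IsCoprime ((q₂ * r : ℕ) : ℤ) a := isCoprime_mul_of_cop ((cop_comm a r q₁ q₂ m).1 hc)
  refine ⟨hk.1, coprime_of_congr hd₁ h1, coprime_of_congr hd₂ h2, hk.2, ?_⟩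
  -- reduce both congruences modulo `q₀ r`
  have e1 := congrArg (ZMod.castHom (gmod_dvd_left r q₁ q₂) (ZMod (gmod r q₁ q₂))) h1
  have e2 := congrArg (ZMod.castHom (gmod_dvd_right r q₁ q₂) (ZMod (gmod r q₁ q₂))) h2
  rw [map_natCast, map_intCast] at e1 e2
  rw [← e2, Nat.cast_mul, Nat.cast_mul] at e1
  -- cancel the unit `m`
  have hm : IsUnit (m : ZMod (gmod r q₁ q₂)) := by
    rw [ZMod.isUnit_iff_coprime]
    exact Nat.Coprime.coprime_dvd_right
      ((gmod_dvd_left r q₁ q₂).trans (show q₁ * r ∣ q₁ * q₂ * r from ⟨q₂, by ring⟩)) hk.2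
  exact hm.mul_left_cancel e1

/-- All solutions of (6.1) form one class modulo `L`: if `m₀` satisfies `Conds` then
`Conds(m) ↔ m ≡ m₀ (mod L)`. [cite: BombieriFriedlanderIwaniecActa1986, §6 (6.1) p. 219] -/
theorem conds_iff_modEq {a : ℤ} {r q₁ q₂ n₁ n₂ m₀ : ℕ} (h₀ : Conds a r q₁ q₂ n₁ n₂ m₀) (m : ℕ) :
    Conds a r q₁ q₂ n₁ n₂ m ↔ (m : ZMod (lmod r q₁ q₂)) = (m₀ : ZMod (lmod r q₁ q₂)) := by
  obtain ⟨hka, hn₁, hn₂, hm₀k, _⟩ := conds_consequences h₀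
  obtain ⟨hc₀, h1₀, h2₀⟩ := h₀
  rw [natCast_mul_eq_iff hn₁] at h1₀
  rw [natCast_mul_eq_iff hn₂] at h2₀
  constructor
  · rintro ⟨hc, h1, h2⟩
    rw [natCast_mul_eq_iff hn₁, ← h1₀, ZMod.natCast_eq_natCast_iff] at h1
    rw [natCast_mul_eq_iff hn₂, ← h2₀, ZMod.natCast_eq_natCast_iff] at h2
    rw [ZMod.natCast_eq_natCast_iff, ← lcm_mul_eq_lmod]
    exact Nat.mod_lcm h1 h2
  · intro hm
    rw [ZMod.natCast_eq_natCast_iff] at hm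
    have h1 : (m : ZMod (q₁ * r)) = (m₀ : ZMod (q₁ * r)) :=
      (ZMod.natCast_eq_natCast_iff _ _ _).2 (hm.of_dvd (dvd_lmod_left r q₁ q₂))
    have h2 : (m : ZMod (q₂ * r)) = (m₀ : ZMod (q₂ * r)) :=
      (ZMod.natCast_eq_natCast_iff _ _ _).2 (hm.of_dvd (dvd_lmod_right r q₁ q₂))
    refine ⟨?_, (natCast_mul_eq_iff hn₁ _).2 (h1.trans h1₀), (natCast_mul_eq_iff hn₂ _).2 (h2.trans h2₀)⟩
    rw [cop_iff]
    refine ⟨hka, ?_⟩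
    -- `m ≡ m₀` modulo `q₁ r` and `q₂ r`, and `m₀` is coprime to `q₁ q₂ r`
    have hc1 : m.Coprime (q₁ * r) := by
      have := Nat.Coprime.coprime_dvd_right
        (show q₁ * r ∣ q₁ * q₂ * r from ⟨q₂, by ring⟩) hm₀k
      rw [← ZMod.isUnit_iff_coprime] at this ⊢
      rwa [h1]
    have hc2 : m.Coprime (q₂ * r) := by
      have := Nat.Coprime.coprime_dvd_right
        (show q₂ * r ∣ q₁ * q₂ * r from ⟨q₁, by ring⟩) hm₀k
      rw [← ZMod.isUnit_iff_coprime] at this ⊢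
      rwa [h2]
    have hq₁ : m.Coprime q₁ := Nat.Coprime.coprime_dvd_right (show q₁ ∣ q₁ * r from ⟨r, rfl⟩) hc1
    have hq₂ : m.Coprime q₂ := Nat.Coprime.coprime_dvd_right (show q₂ ∣ q₂ * r from ⟨r, rfl⟩) hc2
    have hr : m.Coprime r := Nat.Coprime.coprime_dvd_right (show r ∣ q₁ * r from ⟨q₁, by ring⟩) hc1
    exact Nat.Coprime.mul_right (Nat.Coprime.mul_right hq₁ hq₂) hr

/-- Existence of a solution of (6.1) under the compatibility condition: if `(q₁q₂r, a) = 1`,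
`(nᵢ, qᵢr) = 1` and `n₁ ≡ n₂ (q₀ r)` then some `m` satisfies `Conds` (Chinese remainder theorem
for the moduli `q₁r, q₂r`). [cite: BombieriFriedlanderIwaniecActa1986, §6 (6.1) p. 219] -/
theorem exists_conds {a : ℤ} {r q₁ q₂ n₁ n₂ : ℕ} (hr : 0 < r) (hq₁ : 0 < q₁) (hq₂ : 0 < q₂)
    (hka : IsCoprime ((q₁ * q₂ * r : ℕ) : ℤ) a) (hn₁ : n₁.Coprime (q₁ * r))
    (hn₂ : n₂.Coprime (q₂ * r))
    (hcong : (n₁ : ZMod (gmod r q₁ q₂)) = (n₂ : ZMod (gmod r q₁ q₂))) :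
    ∃ m : ℕ, Conds a r q₁ q₂ n₁ n₂ m := by
  haveI : NeZero (q₁ * r) := ⟨(Nat.mul_pos hq₁ hr).ne'⟩
  haveI : NeZero (q₂ * r) := ⟨(Nat.mul_pos hq₂ hr).ne'⟩
  have hd₁ : IsCoprime ((q₁ * r : ℕ) : ℤ) a := by
    apply IsCoprime.of_mul_left_left (y := (q₂ : ℤ))
    have e : ((q₁ * r : ℕ) : ℤ) * q₂ = ((q₁ * q₂ * r : ℕ) : ℤ) := by push_cast; ring
    rwa [e]
  have hd₂ : IsCoprime ((q₂ * r : ℕ) : ℤ) a := by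
    apply IsCoprime.of_mul_left_left (y := (q₁ : ℤ))
    have e : ((q₂ * r : ℕ) : ℤ) * q₁ = ((q₁ * q₂ * r : ℕ) : ℤ) := by push_cast; ring
    rwa [e]
  set c₁ : ℕ := (invClass a (q₁ * r) n₁).val with hc₁
  set c₂ : ℕ := (invClass a (q₂ * r) n₂).val with hc₂
  -- `cᵢ nᵢ ≡ a (qᵢ r)`
  have hc₁' : ((c₁ * n₁ : ℕ) : ZMod (q₁ * r)) = (a : ZMod (q₁ * r)) := by
    rw [natCast_mul_eq_iff hn₁, hc₁, ZMod.natCast_zmod_val, invClass]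
  have hc₂' : ((c₂ * n₂ : ℕ) : ZMod (q₂ * r)) = (a : ZMod (q₂ * r)) := by
    rw [natCast_mul_eq_iff hn₂, hc₂, ZMod.natCast_zmod_val, invClass]
  -- compatibility modulo `q₀ r`
  have hcomp : c₁ ≡ c₂ [MOD Nat.gcd (q₁ * r) (q₂ * r)] := by
    rw [gcd_mul_eq_gmod, ← ZMod.natCast_eq_natCast_iff]
    have e1 := congrArg (ZMod.castHom (gmod_dvd_left r q₁ q₂) (ZMod (gmod r q₁ q₂))) hc₁'
    have e2 := congrArg (ZMod.castHom (gmod_dvd_right r q₁ q₂) (ZMod (gmod r q₁ q₂))) hc₂'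
    rw [map_natCast, map_intCast] at e1 e2
    rw [← e2, Nat.cast_mul, Nat.cast_mul, ← hcong] at e1
    have hu : IsUnit (n₁ : ZMod (gmod r q₁ q₂)) := by
      rw [ZMod.isUnit_iff_coprime]
      exact Nat.Coprime.coprime_dvd_right (gmod_dvd_left r q₁ q₂) hn₁
    exact hu.mul_right_cancel e1
  obtain ⟨m, hm₁, hm₂⟩ := Nat.chineseRemainder' hcomp
  refine ⟨m, ?_, ?_, ?_⟩
  · rw [cop_iff]
    refine ⟨hka, ?_⟩
    have h1 : (m : ZMod (q₁ * r)) = invClass a (q₁ * r) n₁ := by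
      rw [(ZMod.natCast_eq_natCast_iff _ _ _).2 hm₁, hc₁, ZMod.natCast_zmod_val]
    have h2 : (m : ZMod (q₂ * r)) = invClass a (q₂ * r) n₂ := by
      rw [(ZMod.natCast_eq_natCast_iff _ _ _).2 hm₂, hc₂, ZMod.natCast_zmod_val]
    have hm1 : m.Coprime (q₁ * r) := by
      rw [← ZMod.isUnit_iff_coprime, h1]; exact isUnit_invClass hd₁ hn₁
    have hm2 : m.Coprime (q₂ * r) := by
      rw [← ZMod.isUnit_iff_coprime, h2]; exact isUnit_invClass hd₂ hn₂
    have hq₁' : m.Coprime q₁ := Nat.Coprime.coprime_dvd_right (show q₁ ∣ q₁ * r from ⟨r, rfl⟩) hm1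
    have hq₂' : m.Coprime q₂ := Nat.Coprime.coprime_dvd_right (show q₂ ∣ q₂ * r from ⟨r, rfl⟩) hm2
    have hr' : m.Coprime r := Nat.Coprime.coprime_dvd_right (show r ∣ q₁ * r from ⟨q₁, by ring⟩) hm1
    exact Nat.Coprime.mul_right (Nat.Coprime.mul_right hq₁' hq₂') hr'
  · rw [natCast_mul_eq_iff hn₁, (ZMod.natCast_eq_natCast_iff _ _ _).2 hm₁, hc₁,
      ZMod.natCast_zmod_val, invClass]
  · rw [natCast_mul_eq_iff hn₂, (ZMod.natCast_eq_natCast_iff _ _ _).2 hm₂, hc₂,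
      ZMod.natCast_zmod_val, invClass]


/-! ### Solvability and the solution class -/

/-- Solvability of (6.1): some `m` satisfies `Conds`. [cite: BombieriFriedlanderIwaniecActa1986, §6 (6.1) p. 219] -/
abbrev Solvable (a : ℤ) (r q₁ q₂ n₁ n₂ : ℕ) : Prop := ∃ m : ℕ, Conds a r q₁ q₂ n₁ n₂ m

/-- **Solvability of (6.1)** for `r, q₁, q₂ ≥ 1`: `(q₁q₂r, a) = 1`, `(nᵢ, qᵢr) = 1` and
`n₁ ≡ n₂ (mod q₀ r)`. [cite: BombieriFriedlanderIwaniecActa1986, §6 (6.1) p. 219] -/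
theorem solvable_iff {a : ℤ} {r q₁ q₂ : ℕ} (hr : 0 < r) (hq₁ : 0 < q₁) (hq₂ : 0 < q₂)
    (n₁ n₂ : ℕ) :
    Solvable a r q₁ q₂ n₁ n₂ ↔ IsCoprime ((q₁ * q₂ * r : ℕ) : ℤ) a ∧ n₁.Coprime (q₁ * r) ∧
      n₂.Coprime (q₂ * r) ∧ (n₁ : ZMod (gmod r q₁ q₂)) = (n₂ : ZMod (gmod r q₁ q₂)) := by
  constructor
  · rintro ⟨m, hm⟩
    obtain ⟨h1, h2, h3, _, h5⟩ := conds_consequences hm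
    exact ⟨h1, h2, h3, h5⟩
  · rintro ⟨h1, h2, h3, h4⟩
    exact exists_conds hr hq₁ hq₂ h1 h2 h3 h4

open Classical in
/-- The solution class `μ (mod L)` of (6.1) (or `0` if there is none).
[cite: BombieriFriedlanderIwaniecActa1986, §6 (6.1) p. 219] -/
def solClass (a : ℤ) (r q₁ q₂ n₁ n₂ : ℕ) : ZMod (lmod r q₁ q₂) :=
  if h : Solvable a r q₁ q₂ n₁ n₂ then
    ((Classical.choose (show ∃ m : ℕ, Conds a r q₁ q₂ n₁ n₂ m from h) : ℕ) :
      ZMod (lmod r q₁ q₂)) else 0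

/-- When (6.1) is solvable, `Conds(m) ↔ m ≡ μ (mod L)`. [folklore] -/
theorem conds_iff_eq_solClass {a : ℤ} {r q₁ q₂ n₁ n₂ : ℕ} (h : Solvable a r q₁ q₂ n₁ n₂) (m : ℕ) :
    Conds a r q₁ q₂ n₁ n₂ m ↔ (m : ZMod (lmod r q₁ q₂)) = solClass a r q₁ q₂ n₁ n₂ := by
  unfold solClass
  rw [dif_pos h]
  exact conds_iff_modEq (Classical.choose_spec (show ∃ m : ℕ, Conds a r q₁ q₂ n₁ n₂ m from h)) m

/-- The representative `μ.val` of the solution class itself satisfies `Conds` (`L ≥ 1`). [folklore] -/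
theorem conds_val_solClass {a : ℤ} {r q₁ q₂ n₁ n₂ : ℕ} (hL : 0 < lmod r q₁ q₂)
    (h : Solvable a r q₁ q₂ n₁ n₂) : Conds a r q₁ q₂ n₁ n₂ (solClass a r q₁ q₂ n₁ n₂).val := by
  haveI : NeZero (lmod r q₁ q₂) := ⟨hL.ne'⟩
  rw [conds_iff_eq_solClass h, ZMod.natCast_zmod_val]

open Classical in
/-- For BFI's weight, `A₁ = [solvable] · A(L, μ)` (`A = BFI.classSum`): the `m` with (6.1) form the
class `μ (mod L)`. [cite: BombieriFriedlanderIwaniecActa1986, §6 p. 219] -/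
theorem mA1_bump_eq (a : ℤ) (M Y : ℝ) (r q₁ q₂ n₁ n₂ : ℕ) :
    mA1 a (mRange M Y) (fun m => bump M Y m) r q₁ q₂ n₁ n₂ =
      if Solvable a r q₁ q₂ n₁ n₂ then
        classSum M Y (lmod r q₁ q₂) (solClass a r q₁ q₂ n₁ n₂) else 0 := by
  rw [mA1_eq_sum_filter]
  split_ifs with h
  · unfold classSum
    exact Finset.sum_congr (Finset.filter_congr fun m _ => conds_iff_eq_solClass h m) fun _ _ => rfl
  · refine Finset.sum_eq_zero fun m hm => ?_
    exact absurd ⟨m, (Finset.mem_filter.1 hm).2⟩ h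

/-! ### The phase of the solution class (BFI (6.10)) -/

/-- `q₀ = (q₁, q₂)`. -/
local notation "q₀[" q₁ "," q₂ "]" => Nat.gcd q₁ q₂

/-- The integer `t = (n₁ − n₂)/(q₀ r)` (`= −k` in BFI §8). [cite: BombieriFriedlanderIwaniecActa1986, §8 p. 226] -/
def tInt (r q₁ q₂ n₁ n₂ : ℕ) : ℤ := ((n₁ : ℤ) - n₂) / (gmod r q₁ q₂ : ℕ)

/-- The inverse `u = (n₂ q₁')⁻¹ (mod n₁ q₂')`, as a natural number (`qᵢ' = qᵢ/q₀`).
[cite: BombieriFriedlanderIwaniecActa1986, §6 (6.10) p. 221] -/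
def uNat (q₁ q₂ n₁ n₂ : ℕ) : ℕ :=
  (((n₂ * (q₁ / q₀[q₁,q₂]) : ℕ) : ZMod (n₁ * (q₂ / q₀[q₁,q₂])))⁻¹).val

/-- BFI's phase `h · a (n₁ − n₂)/(q₀r) · \overline{n₂q₁'}/(n₁q₂')` of (6.10), as a real number
(frequency `h ∈ ℤ`). [cite: BombieriFriedlanderIwaniecActa1986, §6 (6.10) p. 221] -/
def bfiPhase (a : ℤ) (r q₁ q₂ n₁ n₂ : ℕ) (h : ℤ) : ℝ :=
  (h : ℝ) * a * (tInt r q₁ q₂ n₁ n₂ : ℝ) * (uNat q₁ q₂ n₁ n₂ : ℝ) / ((n₁ : ℝ) * (q₂ / q₀[q₁,q₂] : ℕ))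

/-- Arithmetic of `q₀, q₁', q₂'`: `q₁ = q₀ q₁'`, `q₂ = q₀ q₂'`, `(q₁', q₂') = 1`, `[q₁,q₂] = q₀q₁'q₂'`
(`q₁, q₂ ≥ 1`). [folklore] -/
theorem gcd_div_facts {q₁ : ℕ} (q₂ : ℕ) (hq₁ : 0 < q₁) :
    q₁ = q₀[q₁,q₂] * (q₁ / q₀[q₁,q₂]) ∧ q₂ = q₀[q₁,q₂] * (q₂ / q₀[q₁,q₂]) ∧
      (q₁ / q₀[q₁,q₂]).Coprime (q₂ / q₀[q₁,q₂]) ∧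
      Nat.lcm q₁ q₂ = q₀[q₁,q₂] * (q₁ / q₀[q₁,q₂]) * (q₂ / q₀[q₁,q₂]) ∧ 0 < q₀[q₁,q₂] := by
  have hg : 0 < q₀[q₁,q₂] := Nat.gcd_pos_of_pos_left _ hq₁
  have e1 : q₁ = q₀[q₁,q₂] * (q₁ / q₀[q₁,q₂]) := (Nat.mul_div_cancel' (Nat.gcd_dvd_left _ _)).symm
  have e2 : q₂ = q₀[q₁,q₂] * (q₂ / q₀[q₁,q₂]) := (Nat.mul_div_cancel' (Nat.gcd_dvd_right _ _)).symm
  refine ⟨e1, e2, Nat.coprime_div_gcd_div_gcd hg, ?_, hg⟩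
  have h := Nat.gcd_mul_lcm q₁ q₂
  have h2 : q₀[q₁,q₂] * Nat.lcm q₁ q₂ =
      q₀[q₁,q₂] * (q₀[q₁,q₂] * (q₁ / q₀[q₁,q₂]) * (q₂ / q₀[q₁,q₂])) := by
    rw [h]
    calc q₁ * q₂ = (q₀[q₁,q₂] * (q₁ / q₀[q₁,q₂])) * (q₀[q₁,q₂] * (q₂ / q₀[q₁,q₂])) := by
          rw [← e1, ← e2]
      _ = _ := by ring
  exact Nat.eq_of_mul_eq_mul_left hg h2

/-- **The phase identity (6.10)** as a divisibility: if `m` satisfies (6.1) and `(n₁, n₂) = 1`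
then `L n₁ ∣ m n₁ − a t u q₀ q₁' r − a`, i.e.
`m/L ≡ a t u/(n₁ q₂') + a/(L n₁) (mod 1)` with `t = (n₁ − n₂)/(q₀r)`, `u = (n₂q₁')⁻¹ mod n₁q₂'`
(BFI p. 221: "`μ/(q₀q₁q₂r) ≡ a (n₁−n₂)/(q₀r) · (n₂q₁)‾/(n₁q₂) + a/(q₀q₁q₂rn₁) (mod 1)`").
[cite: BombieriFriedlanderIwaniecActa1986, §6 (6.10) p. 221] -/
theorem phase_dvd {a : ℤ} {r q₁ q₂ n₁ n₂ m : ℕ} (hr : 0 < r) (hq₁ : 0 < q₁) (hq₂ : 0 < q₂)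
    (hn₁ : 0 < n₁) (hcop : n₁.Coprime n₂) (hm : Conds a r q₁ q₂ n₁ n₂ m) :
    ((lmod r q₁ q₂ * n₁ : ℕ) : ℤ) ∣
      (m : ℤ) * n₁ - a * tInt r q₁ q₂ n₁ n₂ * (uNat q₁ q₂ n₁ n₂ : ℤ) *
        ((q₀[q₁,q₂] * (q₁ / q₀[q₁,q₂]) * r : ℕ) : ℤ) - a := by
  obtain ⟨e1, e2, hcop', elcm, hg⟩ := gcd_div_facts q₂ hq₁
  obtain ⟨hka, hn₁c, hn₂c, hmk, hcong⟩ := conds_consequences hm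
  obtain ⟨_, hm1, hm2⟩ := hm
  -- the two congruences as divisibilities
  obtain ⟨s, hs⟩ := int_dvd_of_natCast_mul_eq hm1
  obtain ⟨s₂, hs₂⟩ := int_dvd_of_natCast_mul_eq hm2
  -- `n₁ ≡ n₂ (q₀ r)`: `n₁ − n₂ = q₀ r t`
  have ht : ((n₁ : ℤ) - n₂) = (gmod r q₁ q₂ : ℕ) * tInt r q₁ q₂ n₁ n₂ := by
    unfold tInt
    rw [Int.mul_ediv_cancel']
    rw [← ZMod.intCast_eq_intCast_iff_dvd_sub]
    push_cast
    exact hcong.symm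
  -- `u n₂ q₁' ≡ 1 (n₁ q₂')`
  have hp₁pos : 0 < q₁ / q₀[q₁,q₂] :=
    Nat.div_pos (Nat.le_of_dvd hq₁ (Nat.gcd_dvd_left _ _)) hg
  have hp₂pos : 0 < q₂ / q₀[q₁,q₂] :=
    Nat.div_pos (Nat.le_of_dvd hq₂ (Nat.gcd_dvd_right _ _)) hg
  have hN : 0 < n₁ * (q₂ / q₀[q₁,q₂]) := Nat.mul_pos hn₁ hp₂pos
  haveI : NeZero (n₁ * (q₂ / q₀[q₁,q₂])) := ⟨hN.ne'⟩
  have hcopU : (n₂ * (q₁ / q₀[q₁,q₂])).Coprime (n₁ * (q₂ / q₀[q₁,q₂])) := by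
    have h1 : n₂.Coprime n₁ := hcop.symm
    have h2 : n₂.Coprime (q₂ / q₀[q₁,q₂]) :=
      Nat.Coprime.coprime_dvd_right
        ((Nat.div_dvd_of_dvd (Nat.gcd_dvd_right q₁ q₂)).trans (dvd_mul_right q₂ r)) hn₂c
    have h3 : (q₁ / q₀[q₁,q₂]).Coprime n₁ :=
      (Nat.Coprime.coprime_dvd_right
        ((Nat.div_dvd_of_dvd (Nat.gcd_dvd_left q₁ q₂)).trans (dvd_mul_right q₁ r)) hn₁c).symm
    exact Nat.Coprime.mul_left (Nat.Coprime.mul_right h1 h2) (Nat.Coprime.mul_right h3 hcop')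
  have hu : (((uNat q₁ q₂ n₁ n₂ * (n₂ * (q₁ / q₀[q₁,q₂])) : ℕ) : ℤ) :
      ZMod (n₁ * (q₂ / q₀[q₁,q₂]))) = ((1 : ℤ) : ZMod (n₁ * (q₂ / q₀[q₁,q₂]))) := by
    rw [Int.cast_natCast, Nat.cast_mul, uNat, ZMod.natCast_zmod_val, Int.cast_one]
    exact ZMod.inv_mul_of_unit _ ((ZMod.isUnit_iff_coprime _ _).2 hcopU)
  rw [ZMod.intCast_eq_intCast_iff_dvd_sub] at hu
  obtain ⟨v, hv⟩ := hu
  -- the integer identity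
  have eD₁ : ((q₁ * r : ℕ) : ℤ) = (q₀[q₁,q₂] : ℤ) * (q₁ / q₀[q₁,q₂] : ℕ) * r := by
    conv_lhs => rw [e1]
    simp only [Nat.cast_mul]
  have eD₂ : ((q₂ * r : ℕ) : ℤ) = (q₀[q₁,q₂] : ℤ) * (q₂ / q₀[q₁,q₂] : ℕ) * r := by
    conv_lhs => rw [e2]
    simp only [Nat.cast_mul]
  have eG : ((gmod r q₁ q₂ : ℕ) : ℤ) = (q₀[q₁,q₂] : ℤ) * r := by
    unfold gmod
    simp only [Nat.cast_mul]
  rw [eD₁] at hs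
  rw [eD₂] at hs₂
  rw [eG] at ht
  simp only [Nat.cast_mul] at hs hs₂ hv ht
  have key : ((q₀[q₁,q₂] : ℤ) * r) *
      ((s - a * tInt r q₁ q₂ n₁ n₂ * (uNat q₁ q₂ n₁ n₂ : ℤ)) * (n₂ * (q₁ / q₀[q₁,q₂] : ℕ)) -
        (n₁ * (q₂ / q₀[q₁,q₂] : ℕ)) * (s₂ + a * tInt r q₁ q₂ n₁ n₂ * v)) = 0 := by
    linear_combination (-(n₂ : ℤ)) * hs + (n₁ : ℤ) * hs₂ +
      a * tInt r q₁ q₂ n₁ n₂ * ((q₀[q₁,q₂] : ℤ) * r) * hv + a * ht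
  have hgr : ((q₀[q₁,q₂] : ℤ) * r) ≠ 0 := by
    have : (0 : ℤ) < (q₀[q₁,q₂] : ℤ) * r := by positivity
    exact this.ne'
  have key2 : (s - a * tInt r q₁ q₂ n₁ n₂ * (uNat q₁ q₂ n₁ n₂ : ℤ)) * (n₂ * (q₁ / q₀[q₁,q₂] : ℕ)) =
      (n₁ * (q₂ / q₀[q₁,q₂] : ℕ)) * (s₂ + a * tInt r q₁ q₂ n₁ n₂ * v) := by
    rcases mul_eq_zero.1 key with h | h
    · exact absurd h hgr
    · linarith
  -- `n₁ q₂' ∣ s − a t u`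
  have hdvd : ((n₁ * (q₂ / q₀[q₁,q₂]) : ℕ) : ℤ) ∣ (s - a * tInt r q₁ q₂ n₁ n₂ * (uNat q₁ q₂ n₁ n₂ : ℤ)) := by
    have hc : IsCoprime ((n₁ * (q₂ / q₀[q₁,q₂]) : ℕ) : ℤ) ((n₂ * (q₁ / q₀[q₁,q₂]) : ℕ) : ℤ) :=
      Nat.isCoprime_iff_coprime.2 hcopU.symm
    refine IsCoprime.dvd_of_dvd_mul_right hc ?_
    simp only [Nat.cast_mul]
    rw [key2]
    exact Dvd.intro _ rfl
  -- conclude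
  have eL : ((lmod r q₁ q₂ * n₁ : ℕ) : ℤ) =
      ((q₀[q₁,q₂] : ℤ) * (q₁ / q₀[q₁,q₂] : ℕ) * r) * ((n₁ * (q₂ / q₀[q₁,q₂]) : ℕ) : ℤ) := by
    unfold lmod
    rw [elcm]
    simp only [Nat.cast_mul]
    ring
  rw [eL]
  have egoal : (m : ℤ) * n₁ - a * tInt r q₁ q₂ n₁ n₂ * (uNat q₁ q₂ n₁ n₂ : ℤ) *
        ((q₀[q₁,q₂] * (q₁ / q₀[q₁,q₂]) * r : ℕ) : ℤ) - a =
      ((q₀[q₁,q₂] : ℤ) * (q₁ / q₀[q₁,q₂] : ℕ) * r) *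
        (s - a * tInt r q₁ q₂ n₁ n₂ * (uNat q₁ q₂ n₁ n₂ : ℤ)) := by
    simp only [Nat.cast_mul]
    linear_combination hs
  rw [egoal]
  exact mul_dvd_mul_left _ hdvd


/-- **The phase of the solution class** (BFI (6.10): "`e(−μh/(q₀q₁q₂r)) = e(ah (n₂−n₁)/(q₀r) ·
(n₂q₁)‾/(n₁q₂)) + O(|ah|/(q₀q₁q₂rn₁))`"), in the tree's Fourier conventions: for a solvable
(6.1) with `(n₁, n₂) = 1`, every frequency `h ∈ ℤ` satisfies
`‖e(μh/L) Φ_L(h) − e(bfiPhase h) Φ_L(h)‖ ≤ 2π |h||a|/(L n₁) · (M + 2Y)`.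
[cite: BombieriFriedlanderIwaniecActa1986, §6 (6.10) p. 221] -/
theorem norm_twCoef_sub_phase_le {a : ℤ} {M Y : ℝ} (hY : 0 < Y) (hM : 0 ≤ M)
    {r q₁ q₂ n₁ n₂ : ℕ} (hr : 0 < r) (hq₁ : 0 < q₁) (hq₂ : 0 < q₂) (hn₁ : 0 < n₁)
    (hcop : n₁.Coprime n₂) (hsol : Solvable a r q₁ q₂ n₁ n₂) (h : ℤ) :
    ‖twCoef M Y (lmod r q₁ q₂) (solClass a r q₁ q₂ n₁ n₂) h -
        (𝐞 (bfiPhase a r q₁ q₂ n₁ n₂ h) : ℂ) * fcoef M Y (lmod r q₁ q₂) h‖ ≤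
      2 * π * (|(h : ℝ)| * |(a : ℝ)| / ((lmod r q₁ q₂ : ℝ) * n₁)) * (M + 2 * Y) := by
  have hL := lmod_pos hr hq₁ hq₂
  haveI : NeZero (lmod r q₁ q₂) := ⟨hL.ne'⟩
  have hC := conds_val_solClass hL hsol
  obtain ⟨z, hz⟩ := phase_dvd hr hq₁ hq₂ hn₁ hcop hC
  obtain ⟨e1, e2, _, elcm, hg⟩ := gcd_div_facts q₂ hq₁
  have hp₂pos : 0 < q₂ / q₀[q₁,q₂] :=
    Nat.div_pos (Nat.le_of_dvd hq₂ (Nat.gcd_dvd_right _ _)) hg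
  -- cast the divisibility to `ℝ`
  have hzR : ((solClass a r q₁ q₂ n₁ n₂).val : ℝ) * n₁ -
      a * (tInt r q₁ q₂ n₁ n₂ : ℝ) * (uNat q₁ q₂ n₁ n₂ : ℝ) *
        ((q₀[q₁,q₂] : ℝ) * (q₁ / q₀[q₁,q₂] : ℕ) * r) - a =
      ((lmod r q₁ q₂ : ℝ) * n₁) * z := by
    have hz' := congrArg (fun x : ℤ => (x : ℝ)) hz
    simp only [Int.cast_sub, Int.cast_mul, Int.cast_natCast, Nat.cast_mul] at hz'
    exact hz'
  have eL : (lmod r q₁ q₂ : ℝ) = ((q₀[q₁,q₂] : ℝ) * (q₁ / q₀[q₁,q₂] : ℕ) * r) * (q₂ / q₀[q₁,q₂] : ℕ) := by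
    unfold lmod
    rw [elcm]
    push_cast
    ring
  have hn₁' : (0 : ℝ) < n₁ := by exact_mod_cast hn₁
  have hD : (0 : ℝ) < (q₀[q₁,q₂] : ℝ) * (q₁ / q₀[q₁,q₂] : ℕ) * r := by
    have : 0 < q₁ / q₀[q₁,q₂] := Nat.div_pos (Nat.le_of_dvd hq₁ (Nat.gcd_dvd_left _ _)) hg
    positivity
  have hp₂' : (0 : ℝ) < (q₂ / q₀[q₁,q₂] : ℕ) := by exact_mod_cast hp₂pos
  have hp₁' : (0 : ℝ) < (q₁ / q₀[q₁,q₂] : ℕ) := by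
    exact_mod_cast Nat.div_pos (Nat.le_of_dvd hq₁ (Nat.gcd_dvd_left _ _)) hg
  have hg' : (0 : ℝ) < (q₀[q₁,q₂] : ℝ) := by exact_mod_cast hg
  have hr' : (0 : ℝ) < r := by exact_mod_cast hr
  -- the phase identity over `ℝ`
  have key : ((solClass a r q₁ q₂ n₁ n₂).val : ℝ) * h / (lmod r q₁ q₂ : ℝ) =
      bfiPhase a r q₁ q₂ n₁ n₂ h + ((h : ℝ) * a / ((lmod r q₁ q₂ : ℝ) * n₁) + ((h * z : ℤ) : ℝ)) := by
    have hμ : ((solClass a r q₁ q₂ n₁ n₂).val : ℝ) =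
        (a * (tInt r q₁ q₂ n₁ n₂ : ℝ) * (uNat q₁ q₂ n₁ n₂ : ℝ) *
          ((q₀[q₁,q₂] : ℝ) * (q₁ / q₀[q₁,q₂] : ℕ) * r) + a + ((lmod r q₁ q₂ : ℝ) * n₁) * z) / n₁ := by
      rw [eq_div_iff hn₁'.ne']
      linarith
    unfold bfiPhase
    rw [hμ, eL]
    push_cast
    field_simp
    ring
  -- conclude
  unfold twCoef
  rw [key, ← add_assoc, AddChar.map_add_eq_mul, Circle.coe_mul, e_intCast, mul_one, ← sub_mul,
    norm_mul]
  refine mul_le_mul ?_ (norm_fcoef_le hY hM _ _) (norm_nonneg _) (by positivity)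
  refine (norm_e_add_sub_e_le _ _).trans (le_of_eq ?_)
  rw [abs_div, abs_mul, abs_mul, abs_of_pos (by positivity : (0 : ℝ) < (lmod r q₁ q₂ : ℝ)),
    Nat.abs_cast]


/-! ### `𝒮₁` on the coprime pairs: `f̂(0) 𝒳 + ℛ₁ +` (Poisson tail) `+` (phase error) -/

/-- The main range of `𝒮₁`: `(n₁, n₂) = 1` and `q₀ = (q₁, q₂) ≤ Q₀` (BFI (6.6)–(6.7) with (A₄):
`n₀ = 1`). [cite: BombieriFriedlanderIwaniecActa1986, §6 (6.6)–(6.7) p. 220] -/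
abbrev Main (Q₀ : ℝ) (q₁ q₂ n₁ n₂ : ℕ) : Prop := n₁.Coprime n₂ ∧ (Nat.gcd q₁ q₂ : ℝ) ≤ Q₀

/-- `𝒮₁` restricted to the main range (`(n₁,n₂) = 1`, `q₀ ≤ Q₀`): BFI's `𝒮₁*`/`𝒮₁**` of §6.
[cite: BombieriFriedlanderIwaniecActa1986, §6 (6.6)–(6.8) p. 220] -/
def dS1c (a : ℤ) (S : Finset ℕ) (N Q R Q₀ : ℝ) (w β γ : ℕ → ℝ) : ℝ :=
  ∑ r ∈ dyadic R, ∑ q₁ ∈ dyadic Q, ∑ q₂ ∈ dyadic Q, ∑ n₁ ∈ dyadic N, ∑ n₂ ∈ dyadic N,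
    if Main Q₀ q₁ q₂ n₁ n₂ then γ q₁ * γ q₂ * β n₁ * β n₂ * mA1 a S w r q₁ q₂ n₁ n₂ else 0

/-- `𝒮₁` off the main range (`(n₁, n₂) > 1` or `q₀ > Q₀`: BFI's `𝒮₁(n₀ > N₀)` and
`𝒮₁(q₀ > Q₀)` of (6.3)–(6.4)). [cite: BombieriFriedlanderIwaniecActa1986, §6 (6.3)–(6.4) p. 220] -/
def dS1n (a : ℤ) (S : Finset ℕ) (N Q R Q₀ : ℝ) (w β γ : ℕ → ℝ) : ℝ :=
  ∑ r ∈ dyadic R, ∑ q₁ ∈ dyadic Q, ∑ q₂ ∈ dyadic Q, ∑ n₁ ∈ dyadic N, ∑ n₂ ∈ dyadic N,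
    if Main Q₀ q₁ q₂ n₁ n₂ then 0 else γ q₁ * γ q₂ * β n₁ * β n₂ * mA1 a S w r q₁ q₂ n₁ n₂

/-- `𝒮₁ = 𝒮₁(main range) + 𝒮₁(rest)`. [folklore] -/
theorem dS1_eq_dS1c_add_dS1n (a : ℤ) (S : Finset ℕ) (N Q R Q₀ : ℝ) (w β γ : ℕ → ℝ) :
    dS1 a S N Q R w β γ = dS1c a S N Q R Q₀ w β γ + dS1n a S N Q R Q₀ w β γ := by
  unfold dS1 dS1c dS1n
  simp only [← Finset.sum_add_distrib]
  refine Finset.sum_congr rfl fun _ _ => Finset.sum_congr rfl fun _ _ =>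
    Finset.sum_congr rfl fun _ _ => Finset.sum_congr rfl fun _ _ =>
    Finset.sum_congr rfl fun _ _ => ?_
  split_ifs <;> ring

open Classical in
/-- **The main term `𝒳`** of BFI (6.13), p. 221 (without `μ²(n₁n₂)`):
`𝒳 = ∑_{(n₁,n₂)=1, q₀ ≤ Q₀, (6.1) solvable} γ_{q₁}γ_{q₂}β_{n₁}β_{n₂} / L`, `L = [q₁,q₂] r`;
solvability = `(q₁q₂r,a)=1 ∧ (nᵢ,qᵢr)=1 ∧ n₁ ≡ n₂ (q₀r)` (`BFI.solvable_iff`).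
[cite: BombieriFriedlanderIwaniecActa1986, §6 (6.13) p. 221] -/
def calX (a : ℤ) (N Q R Q₀ : ℝ) (β γ : ℕ → ℝ) : ℝ :=
  ∑ r ∈ dyadic R, ∑ q₁ ∈ dyadic Q, ∑ q₂ ∈ dyadic Q, ∑ n₁ ∈ dyadic N, ∑ n₂ ∈ dyadic N,
    if Main Q₀ q₁ q₂ n₁ n₂ ∧ Solvable a r q₁ q₂ n₁ n₂ then
      γ q₁ * γ q₂ * β n₁ * β n₂ / (lmod r q₁ q₂ : ℝ) else 0

/-- The `h`-sum of `ℛ₁` at one index: `∑_{1 ≤ |h| ≤ H} e(bfiPhase h) Φ_L(h)`.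
[cite: BombieriFriedlanderIwaniecActa1986, §6 (6.14) p. 221] -/
def oscR (a : ℤ) (M Y : ℝ) (r q₁ q₂ n₁ n₂ : ℕ) (H : ℕ) : ℂ :=
  ∑ h ∈ Finset.Icc 1 H, ((𝐞 (bfiPhase a r q₁ q₂ n₁ n₂ h) : ℂ) * fcoef M Y (lmod r q₁ q₂) h +
    (𝐞 (bfiPhase a r q₁ q₂ n₁ n₂ (-(h : ℤ))) : ℂ) * fcoef M Y (lmod r q₁ q₂) (-(h : ℤ)))

open Classical in
/-- **The remainder `ℛ₁`** of BFI (6.14), p. 221, in the tree's Fourier conventions: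
`ℛ₁ = ∑_{(n₁,n₂)=1, q₀≤Q₀, solvable} γ_{q₁}γ_{q₂}β_{n₁}β_{n₂} L⁻¹ ∑_{1≤|h|≤H} Φ_L(h) e(h a t (n₂q₁')‾/(n₁q₂'))`.
[cite: BombieriFriedlanderIwaniecActa1986, §6 (6.14) p. 221] -/
def calR1 (a : ℤ) (M Y N Q R Q₀ : ℝ) (β γ : ℕ → ℝ) (H : ℕ) : ℂ :=
  ∑ r ∈ dyadic R, ∑ q₁ ∈ dyadic Q, ∑ q₂ ∈ dyadic Q, ∑ n₁ ∈ dyadic N, ∑ n₂ ∈ dyadic N,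
    if Main Q₀ q₁ q₂ n₁ n₂ ∧ Solvable a r q₁ q₂ n₁ n₂ then
      ((γ q₁ * γ q₂ * β n₁ * β n₂ : ℝ) : ℂ) *
        (((lmod r q₁ q₂ : ℂ))⁻¹ * oscR a M Y r q₁ q₂ n₁ n₂ H) else 0

/-- The error weight of one index in `𝒮₁(coprime) − f̂(0)𝒳 − ℛ₁`: Poisson tail plus phase error,
`L⁻¹ tailBound(Y,j,L,H) + L⁻¹ · 2(M+2Y) · 2π|a|H²/(L n₁)`. [folklore] -/
def errS1 (a : ℤ) (M Y : ℝ) (j H : ℕ) (r q₁ q₂ n₁ : ℕ) : ℝ :=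
  (lmod r q₁ q₂ : ℝ)⁻¹ * tailBound Y j (lmod r q₁ q₂) H +
    (lmod r q₁ q₂ : ℝ)⁻¹ * (2 * (M + 2 * Y)) *
      (2 * π * (|(a : ℝ)| * (H : ℝ) ^ 2 / ((lmod r q₁ q₂ : ℝ) * n₁)))

/-- `errS1 ≥ 0`. [folklore] -/
theorem errS1_nonneg (a : ℤ) {M Y : ℝ} (hY : 0 < Y) (hM : 0 ≤ M) (j H : ℕ) (r q₁ q₂ n₁ : ℕ) :
    0 ≤ errS1 a M Y j H r q₁ q₂ n₁ := by
  unfold errS1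
  have := tailBound_nonneg hY j (lmod r q₁ q₂) H
  positivity

/-- `‖oscSum(L, μ, H) − oscR(H)‖ ≤ 2(M+2Y) · 2π|a| H²/(L n₁)`: the phases replaced by BFI's
(6.10), frequency by frequency. [cite: BombieriFriedlanderIwaniecActa1986, §6 (6.10) p. 221] -/
theorem norm_oscSum_sub_oscR_le {a : ℤ} {M Y : ℝ} (hY : 0 < Y) (hM : 0 ≤ M)
    {r q₁ q₂ n₁ n₂ : ℕ} (hr : 0 < r) (hq₁ : 0 < q₁) (hq₂ : 0 < q₂) (hn₁ : 0 < n₁)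
    (hcop : n₁.Coprime n₂) (hsol : Solvable a r q₁ q₂ n₁ n₂) (H : ℕ) :
    ‖oscSum M Y (lmod r q₁ q₂) (solClass a r q₁ q₂ n₁ n₂) H - oscR a M Y r q₁ q₂ n₁ n₂ H‖ ≤
      (2 * (M + 2 * Y)) * (2 * π * (|(a : ℝ)| * (H : ℝ) ^ 2 / ((lmod r q₁ q₂ : ℝ) * n₁))) := by
  unfold oscSum oscR
  rw [← Finset.sum_sub_distrib]
  have hL : (0 : ℝ) < (lmod r q₁ q₂ : ℝ) := by exact_mod_cast lmod_pos hr hq₁ hq₂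
  have hn₁' : (0 : ℝ) < n₁ := by exact_mod_cast hn₁
  have hterm : ∀ h ∈ Finset.Icc 1 H,
      ‖twCoef M Y (lmod r q₁ q₂) (solClass a r q₁ q₂ n₁ n₂) h +
          twCoef M Y (lmod r q₁ q₂) (solClass a r q₁ q₂ n₁ n₂) (-(h : ℤ)) -
        ((𝐞 (bfiPhase a r q₁ q₂ n₁ n₂ h) : ℂ) * fcoef M Y (lmod r q₁ q₂) h +
          (𝐞 (bfiPhase a r q₁ q₂ n₁ n₂ (-(h : ℤ))) : ℂ) * fcoef M Y (lmod r q₁ q₂) (-(h : ℤ)))‖ ≤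
      2 * (2 * π * ((h : ℝ) * |(a : ℝ)| / ((lmod r q₁ q₂ : ℝ) * n₁)) * (M + 2 * Y)) := by
    intro h hh
    have h1 := norm_twCoef_sub_phase_le hY hM hr hq₁ hq₂ hn₁ hcop hsol (h : ℤ)
    have h2 := norm_twCoef_sub_phase_le hY hM hr hq₁ hq₂ hn₁ hcop hsol (-(h : ℤ))
    rw [Int.cast_natCast, Nat.abs_cast] at h1
    rw [Int.cast_neg, Int.cast_natCast, abs_neg, Nat.abs_cast] at h2
    calc _ = ‖(twCoef M Y (lmod r q₁ q₂) (solClass a r q₁ q₂ n₁ n₂) h -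
              (𝐞 (bfiPhase a r q₁ q₂ n₁ n₂ h) : ℂ) * fcoef M Y (lmod r q₁ q₂) h) +
            (twCoef M Y (lmod r q₁ q₂) (solClass a r q₁ q₂ n₁ n₂) (-(h : ℤ)) -
              (𝐞 (bfiPhase a r q₁ q₂ n₁ n₂ (-(h : ℤ))) : ℂ) * fcoef M Y (lmod r q₁ q₂) (-(h : ℤ)))‖ := by
          ring_nf
      _ ≤ _ := norm_add_le _ _
      _ ≤ _ := add_le_add h1 h2
      _ = _ := by ring
  refine (norm_sum_le _ _).trans ((Finset.sum_le_sum hterm).trans ?_)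
  calc ∑ h ∈ Finset.Icc 1 H, 2 * (2 * π * ((h : ℝ) * |(a : ℝ)| / ((lmod r q₁ q₂ : ℝ) * n₁)) *
          (M + 2 * Y))
      ≤ ∑ h ∈ Finset.Icc 1 H, 2 * (2 * π * ((H : ℝ) * |(a : ℝ)| / ((lmod r q₁ q₂ : ℝ) * n₁)) *
          (M + 2 * Y)) := by
        refine Finset.sum_le_sum fun h hh' => ?_
        gcongr
        exact (Finset.mem_Icc.1 hh').2
    _ = (H : ℝ) * (2 * (2 * π * ((H : ℝ) * |(a : ℝ)| / ((lmod r q₁ q₂ : ℝ) * n₁)) *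
          (M + 2 * Y))) := by
        rw [Finset.sum_const, Nat.card_Icc, Nat.add_sub_cancel, nsmul_eq_mul]
    _ = _ := by ring

open Classical in
/-- One index of `𝒮₁(coprime) − f̂(0) 𝒳 − ℛ₁`. [cite: BombieriFriedlanderIwaniecActa1986, §6 (6.8)–(6.14) pp. 220–221] -/
theorem norm_dS1c_term_sub_le {a : ℤ} {M Y : ℝ} (hY : 0 < Y) (hYM : Y ≤ M)
    {r q₁ q₂ n₁ : ℕ} (hr : 0 < r) (hq₁ : 0 < q₁) (hq₂ : 0 < q₂) (hn₁ : 0 < n₁) (n₂ : ℕ)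
    (Q₀ : ℝ) (β γ : ℕ → ℝ) (H : ℕ) {j : ℕ} (hj : 2 ≤ j) :
    ‖((if Main Q₀ q₁ q₂ n₁ n₂ then γ q₁ * γ q₂ * β n₁ * β n₂ *
          mA1 a (mRange M Y) (fun m => bump M Y m) r q₁ q₂ n₁ n₂ else 0 : ℝ) : ℂ) -
        alphaHat M Y * ((if Main Q₀ q₁ q₂ n₁ n₂ ∧ Solvable a r q₁ q₂ n₁ n₂ then
          γ q₁ * γ q₂ * β n₁ * β n₂ / (lmod r q₁ q₂ : ℝ) else 0 : ℝ) : ℂ) -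
        (if Main Q₀ q₁ q₂ n₁ n₂ ∧ Solvable a r q₁ q₂ n₁ n₂ then
          ((γ q₁ * γ q₂ * β n₁ * β n₂ : ℝ) : ℂ) *
            (((lmod r q₁ q₂ : ℂ))⁻¹ * oscR a M Y r q₁ q₂ n₁ n₂ H) else 0)‖ ≤
      if Main Q₀ q₁ q₂ n₁ n₂ ∧ Solvable a r q₁ q₂ n₁ n₂ then
        |γ q₁ * γ q₂ * β n₁ * β n₂| * errS1 a M Y j H r q₁ q₂ n₁ else 0 := by
  have hM : 0 ≤ M := hY.le.trans hYM
  have hL := lmod_pos hr hq₁ hq₂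
  have hL' : (0 : ℝ) < (lmod r q₁ q₂ : ℝ) := by exact_mod_cast hL
  by_cases h : Main Q₀ q₁ q₂ n₁ n₂ ∧ Solvable a r q₁ q₂ n₁ n₂
  · obtain ⟨hmain, hsol⟩ := h
    have hcop : n₁.Coprime n₂ := hmain.1
    rw [if_pos hmain, if_pos ⟨hmain, hsol⟩, if_pos ⟨hmain, hsol⟩, if_pos ⟨hmain, hsol⟩,
      mA1_bump_eq, if_pos hsol]
    set u : ℝ := γ q₁ * γ q₂ * β n₁ * β n₂ with hu
    set L := lmod r q₁ q₂ with hLdef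
    set μ := solClass a r q₁ q₂ n₁ n₂ with hμdef
    have hP := norm_classSum_sub_le hY hYM hL μ H hj
    have hO := norm_oscSum_sub_oscR_le hY hM hr hq₁ hq₂ hn₁ hcop hsol H
    have e : ((u * classSum M Y L μ : ℝ) : ℂ) - alphaHat M Y * ((u / (L : ℝ) : ℝ) : ℂ) -
        (u : ℂ) * (((L : ℂ))⁻¹ * oscR a M Y r q₁ q₂ n₁ n₂ H) =
        (u : ℂ) * (((classSum M Y L μ : ℂ) - (L : ℂ)⁻¹ * (alphaHat M Y + oscSum M Y L μ H)) +
          (L : ℂ)⁻¹ * (oscSum M Y L μ H - oscR a M Y r q₁ q₂ n₁ n₂ H)) := by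
      push_cast
      ring
    rw [e, norm_mul, Complex.norm_real, Real.norm_eq_abs]
    refine mul_le_mul_of_nonneg_left ?_ (abs_nonneg _)
    refine (norm_add_le _ _).trans ?_
    unfold errS1
    refine add_le_add hP ?_
    rw [norm_mul, norm_inv, Complex.norm_natCast, mul_assoc]
    exact mul_le_mul_of_nonneg_left hO (by positivity)
  · rw [if_neg h, if_neg h, if_neg h]
    simp only [mul_zero, Complex.ofReal_zero, sub_zero]
    by_cases hmain : Main Q₀ q₁ q₂ n₁ n₂
    · have hsol : ¬Solvable a r q₁ q₂ n₁ n₂ := fun hs => h ⟨hmain, hs⟩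
      rw [if_pos hmain, mA1_bump_eq, if_neg hsol]
      simp
    · rw [if_neg hmain]
      simp

open Classical in
/-- **`𝒮₁(coprime pairs) = f̂(0) 𝒳 + ℛ₁ + O(Poisson tails + phase errors)`** (BFI §6,
(6.8)–(6.14), pp. 220–221: "To the innermost sum we apply Lemma 2 … (6.9) … (6.10) … Finally,
inserting (6.10) into (6.8) … we obtain `𝒮₁ = f̂(0)𝒳 + ℛ₁ + O(‖β‖²xR⁻¹ℒ^{−A})` (6.11) provided
`NQ²R < x^{2−ε}` (6.12)"), in explicit un-averaged form: for `0 < Y ≤ M`, `N, Q, R ≥ 0`, every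
`H ≥ 0` and `j ≥ 2`,
`‖𝒮₁ᶜ − α̂₀ 𝒳 − ℛ₁‖ ≤ ∑_{(n₁,n₂)=1, q₀≤Q₀, solvable} |γ_{q₁}γ_{q₂}β_{n₁}β_{n₂}| (L⁻¹ tailBound(Y,j,L,H) + L⁻¹ 2(M+2Y) 2π|a|H²/(Ln₁))`.
The choice `H = x^ε L/Y` (6.9), the admissibility of the two errors under (6.12), the estimate of
`𝒳` (§7) and of `ℛ₁` (§8) are done downstream.
[cite: BombieriFriedlanderIwaniecActa1986, §6 (6.8)–(6.14) pp. 220–221] -/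
theorem norm_dS1c_sub_calX_sub_calR1_le {a : ℤ} {M Y : ℝ} (hY : 0 < Y) (hYM : Y ≤ M)
    {N Q R : ℝ} (hN : 0 ≤ N) (hQ : 0 ≤ Q) (hR : 0 ≤ R) (Q₀ : ℝ) (β γ : ℕ → ℝ) (H : ℕ) {j : ℕ}
    (hj : 2 ≤ j) :
    ‖(dS1c a (mRange M Y) N Q R Q₀ (fun m => bump M Y m) β γ : ℂ) -
        alphaHat M Y * (calX a N Q R Q₀ β γ : ℂ) - calR1 a M Y N Q R Q₀ β γ H‖ ≤
      ∑ r ∈ dyadic R, ∑ q₁ ∈ dyadic Q, ∑ q₂ ∈ dyadic Q, ∑ n₁ ∈ dyadic N, ∑ n₂ ∈ dyadic N,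
        if Main Q₀ q₁ q₂ n₁ n₂ ∧ Solvable a r q₁ q₂ n₁ n₂ then
          |γ q₁ * γ q₂ * β n₁ * β n₂| * errS1 a M Y j H r q₁ q₂ n₁ else 0 := by
  unfold dS1c calX calR1
  rw [Complex.ofReal_sum, Complex.ofReal_sum, Finset.mul_sum, ← Finset.sum_sub_distrib,
    ← Finset.sum_sub_distrib]
  refine (norm_sum_le _ _).trans (Finset.sum_le_sum fun r hr => ?_)
  rw [Complex.ofReal_sum, Complex.ofReal_sum, Finset.mul_sum, ← Finset.sum_sub_distrib,
    ← Finset.sum_sub_distrib]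
  refine (norm_sum_le _ _).trans (Finset.sum_le_sum fun q₁ hq₁ => ?_)
  rw [Complex.ofReal_sum, Complex.ofReal_sum, Finset.mul_sum, ← Finset.sum_sub_distrib,
    ← Finset.sum_sub_distrib]
  refine (norm_sum_le _ _).trans (Finset.sum_le_sum fun q₂ hq₂ => ?_)
  rw [Complex.ofReal_sum, Complex.ofReal_sum, Finset.mul_sum, ← Finset.sum_sub_distrib,
    ← Finset.sum_sub_distrib]
  refine (norm_sum_le _ _).trans (Finset.sum_le_sum fun n₁ hn₁ => ?_)
  rw [Complex.ofReal_sum, Complex.ofReal_sum, Finset.mul_sum, ← Finset.sum_sub_distrib,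
    ← Finset.sum_sub_distrib]
  refine (norm_sum_le _ _).trans (Finset.sum_le_sum fun n₂ _ => ?_)
  exact norm_dS1c_term_sub_le hY hYM (pos_of_mem_dyadic hR hr) (pos_of_mem_dyadic hQ hq₁)
    (pos_of_mem_dyadic hQ hq₂) (pos_of_mem_dyadic hN hn₁) n₂ Q₀ β γ H hj

end BFI

end Literature.NumberTheory.Sieve
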